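import Summits.Ventures.AbcSig.Rows.Bridge
import Summits.Ventures.AbcSig.Rows.C2aL109A3S
import Summits.Ventures.AbcSig.Rows.C2aL109A3SAB

/-!
# Venture AbcSig — CELL `C2aL109A3S`: the census statement `Rows.C2aCellRed 109 (fun a => a = 3) ∅` from the two row theorems

HONEST FRAMING. COMPUTATION cell `pub-abcsig`; CONDITIONAL theorem; no claim on ABC or any summit. Hypotheses exactly as in
`Rows/C2aL109A3S.lean` and `Rows/C2aL109A3SAB.lean`: `BS04Package` (CITED), `DataComplete` / `RefinesCPSymAll` (COMPUTED, certified level files;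
norm-form certificates), `EisPackage` (CITED) + `Refines` (COMPUTED) for the kernel M6 discharges, and the rows' per-orbit CITED exclusions universally quantified in the exponent
(suffix `_d1` for `famB`, `_d2` for `famAB`). Conclusion = p1's census predicate (`Rows/Statements.lean`) with the residual of the row of
record `census/rows/C2a/C2a-l109-a3.md` (sha16 `5a171b3975dcde5f`): all four coprime distributions `A·B = 2^3·109^m`, reduced exponents.
GENERATED by p-lean g5 `gen5/c2arow4.py` (pattern of `Rows/C2aL277A0XCell.lean`).
-/

namespace Summit.Ventures.AbcSig

/-- Cell `C2aL109A3S`: `Rows.C2aCellRed 109 (fun a => a = 3) ∅` under the rows' hypotheses. -/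
theorem xcell_C2aL109A3S (M : NewformModel) (hP : M.BS04Package)
    (hE : M.EisPackage)
    (hR_orbit_218_3 : M.Refines 218 orbit_218_3 m6X_218_3)
    (hRB_orbit_3488_10 : ∀ f : M.Form 3488, M.Matches f orbit_3488_10 → M.Matches f rb_3488_10)
    (hD3488 : M.DataComplete 3488 level3488Orbits)
    (hD218 : M.DataComplete 218 level218Orbits)
    (hX_orbit_3488_6_d1 : ∀ n m : ℕ, n ∈ ([13] : List ℕ) → M.Excludes 3488 orbit_3488_6 (famB (2 ^ 3 * 109 ^ m) n (fun _ _ => True)))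
    (hX_orbit_3488_7_d1 : ∀ n m : ℕ, n ∈ ([29] : List ℕ) → M.Excludes 3488 orbit_3488_7 (famB (2 ^ 3 * 109 ^ m) n (fun _ _ => True)))
    (hX_orbit_3488_6_d2 : ∀ n m : ℕ, n ∈ ([13] : List ℕ) → M.Excludes 3488 orbit_3488_6 (famAB (109 ^ m) (2 ^ 3) n (fun _ _ => True)))
    (hX_orbit_3488_7_d2 : ∀ n m : ℕ, n ∈ ([29] : List ℕ) → M.Excludes 3488 orbit_3488_7 (famAB (109 ^ m) (2 ^ 3) n (fun _ _ => True))) :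
    Rows.C2aCellRed 109 (fun a => a = 3) ∅ :=
  C2aCellRed_of_rows 109 (by norm_num) (by norm_num) _ _
    (fun n hn h11 hnℓ _ a m (ha : a = 3) han hm hmn x y z h1 h2 => by
      subst ha
      exact xrow_C2aL109A3S M hP hE hR_orbit_218_3 hRB_orbit_3488_10 hD3488 hD218 n hn h11 hnℓ  m hm hmn (hX_orbit_3488_6_d1 n m) (hX_orbit_3488_7_d1 n m) x y z h1 h2)
    (fun n hn h11 hnℓ _ a m (ha : a = 3) han hm hmn x y z h1 h2 => by
      subst ha
      exact xrow_C2aL109A3SAB M hP hE hR_orbit_218_3 hRB_orbit_3488_10 hD3488 hD218 n hn h11 hnℓ  m hm hmn (hX_orbit_3488_6_d2 n m) (hX_orbit_3488_7_d2 n m) x y z h1 h2)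

end Summit.Ventures.AbcSig
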